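import Literature.Topology.FourManifolds.HandleModelField
import Literature.Topology.FourManifolds.MorseChartChange
import Literature.Topology.FourManifolds.PlanarArch
import Mathlib.MeasureTheory.Integral.IntervalIntegral.FundThmCalculus
import Mathlib.Analysis.Calculus.ContDiff.Deriv
import HarnessLib

/-!
# The thin-handle function of a critical level (Milnor 1963, proof of Thm. 3.2)

Topic `Literature/Topology/FourManifolds` (Morse theory), serving the proof programme for
`Literature.Topology.Immersions.Phillips1967_exists_isLocalDiffeomorph_of_isParallelizable`
(crossing a critical level of index `< n`). Everything here is **proved**; the definitions are
explicit formulas.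

Milnor, *Morse theory* (1963), proof of Thm. 3.2 (pp. 14–17): at a critical point `p` of `f`
with `f(p) = c`, in a Morse chart `f = c - ξ + η` (`ξ = |x⃗|²`, `η = |y⃗|²`), *"choose `ε` …
introduce a new function `F = f - μ(ξ + 2η)` where `μ(0) > ε`, `μ(r) = 0` for `r ≥ 2ε`,
`-1 < μ'(r) ≤ 0`. Assertion 1: `F⁻¹(-∞, c + ε] = M^{c+ε}`. Assertion 2: the critical points of
`F` are the same as those of `f`. Assertion 3: `F⁻¹(-∞, c - ε]` … is `M^{c-ε} ∪ H`"* where the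
"handle" `H` is a neighbourhood of the descending disc. We carry this out with the factor `2`
replaced by a large constant `K`, which makes `H` **thin**: it lies in any prescribed
neighbourhood `N` of `M^{c-ε} ∪ (descending discs)`; and simultaneously at finitely many
critical points of the level `c` (disjoint Morse charts).

* `Literature.Topology.FourManifolds.handleBump ε`, `handleProfile ε` — an explicit profile
  `μ(r) = (9/10) ∫_r^{2ε} ν` with `ν` a smooth plateau (`smoothStep`, `PlanarArch.lean`) equal
  to `1` on `[ε/4, 7ε/4]` and supported in `[ε/8, 15ε/8]`: `μ` is `C^∞`, `μ' = -(9/10) ν ∈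
  (-1, 0]`, `μ = 0` on `[15ε/8, ∞)`, `27ε/20 ≤ μ(0) ≤ 9ε/5` (the integral form gives the slope
  bound `μ' > -1` that a single rescaled `smoothTransition` cannot).
* `Literature.Topology.FourManifolds.thinHandleModel` — the model `c - ξ + η - μ(ξ + K η)` on
  `ℝⁿ` and its only critical point `0` (`eq_zero_of_fderiv_thinHandleModel_eq_zero`:
  `∂F/∂ξ = -1 - μ' < 0`, `∂F/∂η = 1 - K μ' ≥ 1`).
* `Literature.Topology.FourManifolds.exists_thinHandleFunction` — **the thin-handle function**:
  given disjoint Morse charts `e_p` (`f ∘ e_p⁻¹ = c - ξ + η`, closed ball of radius `R` in the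
  target, `2ε ≤ R²`) at the points of a finite set `P`, and an open `N ⊇ M^{c-ε}` containing the
  descending discs `e_p⁻¹{η = 0, ξ ≤ ε}`, there is a `C^∞` function `F ≤ f ≤ F + 2ε` with
  `{F ≤ c + ε} = {f ≤ c + ε}`, `{F ≤ c - ε} ⊆ N`, `F = f` off the chart balls,
  `F(p) ≤ c - 5ε/4` on `P`, and every critical point of `F` outside `P` a critical point of `f`
  with `F = f` there (Milnor's Assertions 1–3, thin form).

## References

* J. Milnor, *Morse theory*, Ann. of Math. Studies 51 (1963), Thm. 3.2 and its proof
  (pp. 14–17). [Milnor1963]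
-/

open scoped Manifold ContDiff Topology
open Set Function Filter Metric MeasureTheory intervalIntegral

noncomputable section

namespace Literature.Topology.FourManifolds

/-! ### The profile `μ` -/

section Profile

variable {ε : ℝ}

/-- The plateau `ν` of the profile: `smoothStep (ε/8) (ε/4) s · smoothStep (ε/8) (ε/4) (2ε - s)`,
equal to `1` on `[ε/4, 7ε/4]`, vanishing for `s ≤ ε/8` and for `s ≥ 15ε/8`, with values in
`[0, 1]`. [cite: Milnor1963, Thm. 3.2 (proof)] -/
def handleBump (ε s : ℝ) : ℝ :=
  smoothStep (ε / 8) (ε / 4) s * smoothStep (ε / 8) (ε / 4) (2 * ε - s)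

/-- `ν` is smooth. [folklore] -/
theorem contDiff_handleBump (ε : ℝ) : ContDiff ℝ ∞ (handleBump ε) :=
  (contDiff_smoothStep _ _).mul ((contDiff_smoothStep _ _).comp (contDiff_const.sub contDiff_id))

/-- `ν` is continuous. [folklore] -/
theorem continuous_handleBump (ε : ℝ) : Continuous (handleBump ε) :=
  (contDiff_handleBump ε).continuous

/-- `0 ≤ ν ≤ 1`. [folklore] -/
theorem handleBump_mem_Icc (ε s : ℝ) : handleBump ε s ∈ Icc (0 : ℝ) 1 := by
  have h1 := smoothStep_mem_Icc (ε / 8) (ε / 4) s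
  have h2 := smoothStep_mem_Icc (ε / 8) (ε / 4) (2 * ε - s)
  exact ⟨mul_nonneg h1.1 h2.1, mul_le_one₀ h1.2 h2.1 h2.2⟩

/-- `ν = 1` on `[ε/4, 7ε/4]`. [folklore] -/
theorem handleBump_eq_one (hε : 0 < ε) {s : ℝ} (hs : s ∈ Icc (ε / 4) (7 * ε / 4)) :
    handleBump ε s = 1 := by
  have hab : ε / 8 < ε / 4 := by linarith
  rw [handleBump, smoothStep_of_ge hab hs.1, smoothStep_of_ge hab (by linarith [hs.2]), one_mul]

/-- `ν = 0` for `s ≤ ε/8`. [folklore] -/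
theorem handleBump_eq_zero_of_le (hε : 0 < ε) {s : ℝ} (hs : s ≤ ε / 8) : handleBump ε s = 0 := by
  have hab : ε / 8 < ε / 4 := by linarith
  rw [handleBump, smoothStep_of_le hab hs, zero_mul]

/-- `ν = 0` for `s ≥ 15ε/8`. [folklore] -/
theorem handleBump_eq_zero_of_ge (hε : 0 < ε) {s : ℝ} (hs : 15 * ε / 8 ≤ s) :
    handleBump ε s = 0 := by
  have hab : ε / 8 < ε / 4 := by linarith
  rw [handleBump, smoothStep_of_le hab (by linarith : 2 * ε - s ≤ ε / 8), mul_zero]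

/-- **The profile** `μ(r) = (9/10) ∫_r^{2ε} ν(s) ds` (Milnor 1963, proof of Thm. 3.2: "a `C^∞`
function `μ` with `μ(0) > ε`, `μ(r) = 0` for `r ≥ 2ε`, `-1 < μ' ≤ 0`").
[cite: Milnor1963, Thm. 3.2 (proof)] -/
def handleProfile (ε r : ℝ) : ℝ :=
  9 / 10 * ∫ s in r..(2 * ε), handleBump ε s

/-- `μ' = -(9/10) ν` (fundamental theorem of calculus). [folklore] -/
theorem hasDerivAt_handleProfile (ε r : ℝ) :
    HasDerivAt (handleProfile ε) (-(9 / 10 * handleBump ε r)) r := by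
  have hcont := continuous_handleBump ε
  have h1 : HasDerivAt (fun u => ∫ s in (2 * ε)..u, handleBump ε s) (handleBump ε r) r :=
    (hcont.integral_hasStrictDerivAt (2 * ε) r).hasDerivAt
  have h2 : HasDerivAt (fun u => ∫ s in u..(2 * ε), handleBump ε s) (-handleBump ε r) r := by
    refine h1.neg.congr_of_eventuallyEq (Eventually.of_forall fun u => ?_)
    exact integral_symm _ _
  have h3 := h2.const_mul (9 / 10)
  simp only [mul_neg] at h3
  exact h3

/-- `μ` is smooth. [folklore] -/
theorem contDiff_handleProfile (ε : ℝ) : ContDiff ℝ ∞ (handleProfile ε) := by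
  rw [contDiff_infty_iff_deriv]
  refine ⟨fun r => (hasDerivAt_handleProfile ε r).differentiableAt, ?_⟩
  have : deriv (handleProfile ε) = fun r => -(9 / 10 * handleBump ε r) :=
    funext fun r => (hasDerivAt_handleProfile ε r).deriv
  rw [this]
  exact (contDiff_const.mul (contDiff_handleBump ε)).neg

/-- The slope bound `-9/10 ≤ μ' ≤ 0` (so `-1 < μ'`). [cite: Milnor1963, Thm. 3.2 (proof)] -/
theorem deriv_handleProfile_mem_Icc (ε r : ℝ) :
    deriv (handleProfile ε) r ∈ Icc (-(9 / 10 : ℝ)) 0 := by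
  rw [(hasDerivAt_handleProfile ε r).deriv]
  have h := handleBump_mem_Icc ε r
  constructor <;> nlinarith [h.1, h.2]

/-- `μ = 0` on `[15ε/8, ∞)` (in particular for `r ≥ 2ε`). [cite: Milnor1963, Thm. 3.2 (proof)] -/
theorem handleProfile_eq_zero_of_ge (hε : 0 < ε) {r : ℝ} (hr : 15 * ε / 8 ≤ r) :
    handleProfile ε r = 0 := by
  have hEq : EqOn (handleBump ε) (fun _ => 0) (uIcc r (2 * ε)) := fun s hs => by
    rw [mem_uIcc] at hs
    refine handleBump_eq_zero_of_ge hε ?_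
    rcases hs with h | h <;> linarith [h.1]
  rw [handleProfile, integral_congr hEq, intervalIntegral.integral_zero, mul_zero]

/-- `μ ≥ 0`. [folklore] -/
theorem handleProfile_nonneg (hε : 0 < ε) (r : ℝ) : 0 ≤ handleProfile ε r := by
  by_cases hr : r ≤ 2 * ε
  · exact mul_nonneg (by norm_num)
      (intervalIntegral.integral_nonneg hr fun s _ => (handleBump_mem_Icc ε s).1)
  · rw [handleProfile_eq_zero_of_ge hε (by linarith)]

/-- `μ` is non-increasing. [folklore] -/
theorem antitone_handleProfile (ε : ℝ) : Antitone (handleProfile ε) :=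
  antitone_of_deriv_nonpos (fun r => (hasDerivAt_handleProfile ε r).differentiableAt)
    fun r => (deriv_handleProfile_mem_Icc ε r).2

/-- `μ(0) ≥ 27ε/20 > ε`: the plateau is `1` on `[ε/4, 7ε/4]`. [cite: Milnor1963, Thm. 3.2 (proof)] -/
theorem le_handleProfile_zero (hε : 0 < ε) : 27 / 20 * ε ≤ handleProfile ε 0 := by
  have hcont := continuous_handleBump ε
  have hint : ∀ a b : ℝ, IntervalIntegrable (handleBump ε) volume a b := fun a b =>
    hcont.intervalIntegrable a b
  have hsplit : ∫ s in (0 : ℝ)..(2 * ε), handleBump ε s =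
      (∫ s in (0 : ℝ)..(ε / 4), handleBump ε s) +
        ((∫ s in (ε / 4)..(7 * ε / 4), handleBump ε s) +
          ∫ s in (7 * ε / 4)..(2 * ε), handleBump ε s) := by
    rw [integral_add_adjacent_intervals (hint _ _) (hint _ _),
      integral_add_adjacent_intervals (hint _ _) (hint _ _)]
  have h1 : 0 ≤ ∫ s in (0 : ℝ)..(ε / 4), handleBump ε s :=
    intervalIntegral.integral_nonneg (by linarith) fun s _ => (handleBump_mem_Icc ε s).1
  have h3 : 0 ≤ ∫ s in (7 * ε / 4)..(2 * ε), handleBump ε s :=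
    intervalIntegral.integral_nonneg (by linarith) fun s _ => (handleBump_mem_Icc ε s).1
  have h2 : ∫ s in (ε / 4)..(7 * ε / 4), handleBump ε s = 3 / 2 * ε := by
    have hEq : EqOn (handleBump ε) (fun _ => (1 : ℝ)) (uIcc (ε / 4) (7 * ε / 4)) := fun s hs => by
      rw [uIcc_of_le (by linarith)] at hs
      exact handleBump_eq_one hε hs
    rw [integral_congr hEq, intervalIntegral.integral_const, smul_eq_mul, mul_one]
    ring
  rw [handleProfile, hsplit, h2]
  nlinarith

/-- `μ(0) ≤ 9ε/5`. [folklore] -/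
theorem handleProfile_zero_le (hε : 0 < ε) : handleProfile ε 0 ≤ 9 / 5 * ε := by
  have hle : ∫ s in (0 : ℝ)..(2 * ε), handleBump ε s ≤ ∫ _ in (0 : ℝ)..(2 * ε), (1 : ℝ) :=
    intervalIntegral.integral_mono_on (by linarith) ((continuous_handleBump ε).intervalIntegrable _ _)
      (continuous_const.intervalIntegrable _ _) fun s _ => (handleBump_mem_Icc ε s).2
  rw [intervalIntegral.integral_const, smul_eq_mul, mul_one, sub_zero] at hle
  rw [handleProfile]
  nlinarith

/-- `μ(r) ≤ μ(0) ≤ 9ε/5` for `r ≥ 0`. [folklore] -/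
theorem handleProfile_le (hε : 0 < ε) {r : ℝ} (hr : 0 ≤ r) : handleProfile ε r ≤ 9 / 5 * ε :=
  (antitone_handleProfile ε hr).trans (handleProfile_zero_le hε)

/-- `μ(r) > 0` forces `r < 15ε/8 < 2ε`. [folklore] -/
theorem lt_of_handleProfile_ne_zero (hε : 0 < ε) {r : ℝ} (hr : handleProfile ε r ≠ 0) :
    r < 15 * ε / 8 := by
  by_contra h
  exact hr (handleProfile_eq_zero_of_ge hε (not_lt.1 h))

end Profile

/-! ### The model on `ℝⁿ` -/

section Model

variable {n : ℕ}

/-- Local notation: `𝔼 n` is the model Euclidean space `EuclideanSpace ℝ (Fin n)`. -/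
local notation "𝔼 " n:arg => EuclideanSpace ℝ (Fin n)

/-- The model thin-handle function `c - ξ + η - μ(ξ + K η)` of index `k` on `ℝⁿ`
(`ξ = sqSumLT k`, `η = sqSumGE k`). [cite: Milnor1963, Thm. 3.2 (proof)] -/
def thinHandleModel (k : ℕ) (c ε K : ℝ) (y : 𝔼 n) : ℝ :=
  c - sqSumLT k y + sqSumGE k y - handleProfile ε (sqSumLT k y + K * sqSumGE k y)

/-- The model is smooth. [folklore] -/
theorem contDiff_thinHandleModel (k : ℕ) (c ε K : ℝ) :
    ContDiff ℝ ∞ (thinHandleModel (n := n) k c ε K) := by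
  unfold thinHandleModel
  exact ((contDiff_const.sub (contDiff_sqSumLT k)).add (contDiff_sqSumGE k)).sub
    ((contDiff_handleProfile ε).comp ((contDiff_sqSumLT k).add (contDiff_const.mul (contDiff_sqSumGE k))))

/-- `ξ ≤ ξ + K η` and `η ≤ (ξ + K η)/K`-type bookkeeping: `‖y‖² ≤ ξ + K η` for `K ≥ 1`. [folklore] -/
theorem norm_sq_le_qK {k : ℕ} {K : ℝ} (hK : 1 ≤ K) (y : 𝔼 n) :
    ‖y‖ ^ 2 ≤ sqSumLT k y + K * sqSumGE k y := by
  rw [← sqSumLT_add_sqSumGE k y]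
  have := sqSumGE_nonneg k y
  nlinarith

/-- The derivative of `ξ` evaluated on the tangential part `yᵀ = (y₀, …, y_{k-1}, 0, …, 0)` of
`y` is `2ξ`, and that of `η` is `0`; on the normal part `yᴺ` they are `0` and `2η`. We package
the four evaluations. [folklore] -/
theorem hasFDerivAt_sqSum_apply_parts (k : ℕ) (y : 𝔼 n) :
    ∃ (Lξ Lη : 𝔼 n →L[ℝ] ℝ) (yT yN : 𝔼 n), HasFDerivAt (sqSumLT (m := n) k) Lξ y ∧
      HasFDerivAt (sqSumGE (m := n) k) Lη y ∧
      Lξ yT = 2 * sqSumLT k y ∧ Lη yT = 0 ∧ Lξ yN = 0 ∧ Lη yN = 2 * sqSumGE k y := by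
  classical
  set ST := Finset.univ.filter (fun i : Fin n => (i : ℕ) < k) with hST
  set SN := Finset.univ.filter (fun i : Fin n => k ≤ (i : ℕ)) with hSN
  set yT : 𝔼 n := WithLp.toLp 2 (fun i => if (i : ℕ) < k then y i else 0) with hyT
  set yN : 𝔼 n := WithLp.toLp 2 (fun i => if (i : ℕ) < k then 0 else y i) with hyN
  have hyTi : ∀ i : Fin n, yT i = if (i : ℕ) < k then y i else 0 := fun i => rfl
  have hyNi : ∀ i : Fin n, yN i = if (i : ℕ) < k then 0 else y i := fun i => rfl
  refine ⟨∑ i ∈ ST, (2 * y i) • (EuclideanSpace.proj (𝕜 := ℝ) i),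
    ∑ i ∈ SN, (2 * y i) • (EuclideanSpace.proj (𝕜 := ℝ) i), yT, yN,
    hasFDerivAt_sum_sq ST y, hasFDerivAt_sum_sq SN y, ?_, ?_, ?_, ?_⟩
  all_goals simp only [FunLike.coe_sum, Finset.sum_apply, FunLike.coe_smul, Pi.smul_apply,
    EuclideanSpace.coe_proj, smul_eq_mul, hyTi, hyNi, sqSumLT, sqSumGE, Finset.mul_sum]
  · refine Finset.sum_congr rfl fun i hi => ?_
    obtain ⟨-, hi⟩ := Finset.mem_filter.1 hi
    rw [if_pos hi]; ring
  · refine Finset.sum_eq_zero fun i hi => ?_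
    obtain ⟨-, hi⟩ := Finset.mem_filter.1 hi
    rw [if_neg (not_lt.2 hi)]; ring
  · refine Finset.sum_eq_zero fun i hi => ?_
    obtain ⟨-, hi⟩ := Finset.mem_filter.1 hi
    rw [if_pos hi]; ring
  · refine Finset.sum_congr rfl fun i hi => ?_
    obtain ⟨-, hi⟩ := Finset.mem_filter.1 hi
    rw [if_neg (not_lt.2 hi)]; ring

/-- **Milnor's Assertion 2 in the model**: for `ε > 0`, `K ≥ 0`, the model function has no
critical point other than `0`: on the tangential part of `y` its derivative is
`-2ξ (1 + μ')`, on the normal part `2η (1 - K μ')`, and `-1 < μ' ≤ 0`.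
[cite: Milnor1963, Thm. 3.2 (proof, Assertion 2)] -/
theorem eq_zero_of_fderiv_thinHandleModel_eq_zero {k : ℕ} {c ε K : ℝ} (hK : 0 ≤ K) {y : 𝔼 n}
    (hy : fderiv ℝ (thinHandleModel (n := n) k c ε K) y = 0) : y = 0 := by
  obtain ⟨Lξ, Lη, yT, yN, hξ, hη, h1, h2, h3, h4⟩ := hasFDerivAt_sqSum_apply_parts k y
  set q := sqSumLT k y + K * sqSumGE k y with hq
  set m := deriv (handleProfile ε) q with hm
  have hμ : HasFDerivAt (fun y : 𝔼 n => handleProfile ε (sqSumLT k y + K * sqSumGE k y))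
      (m • (Lξ + K • Lη)) y := by
    have hin : HasFDerivAt (fun y : 𝔼 n => sqSumLT k y + K * sqSumGE k y) (Lξ + K • Lη) y :=
      hξ.add (hη.const_mul K) |>.congr_fderiv (by ext v; simp [smul_eq_mul])
    have hout : HasDerivAt (handleProfile ε) m q :=
      (hasDerivAt_handleProfile ε q).differentiableAt.hasDerivAt
    have h := hout.comp_hasFDerivAt y hin
    exact h
  have hF : HasFDerivAt (thinHandleModel (n := n) k c ε K)
      ((0 : 𝔼 n →L[ℝ] ℝ) - Lξ + Lη - m • (Lξ + K • Lη)) y := by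
    unfold thinHandleModel
    exact (((hasFDerivAt_const c y).sub hξ).add hη).sub hμ
  have hD : (0 : 𝔼 n →L[ℝ] ℝ) - Lξ + Lη - m • (Lξ + K • Lη) = 0 := by
    rw [← hF.fderiv, hy]
  have hmI := deriv_handleProfile_mem_Icc ε q
  rw [← hm] at hmI
  -- evaluate on the tangential part: `-2ξ(1 + μ') = 0`
  have heval : ∀ v : 𝔼 n, ((0 : 𝔼 n →L[ℝ] ℝ) - Lξ + Lη - m • (Lξ + K • Lη)) v =
      0 - Lξ v + Lη v - m * (Lξ v + K * Lη v) := fun v => by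
    simp only [FunLike.coe_sub, FunLike.coe_add, FunLike.coe_smul, FunLike.coe_zero, Pi.sub_apply,
      Pi.add_apply, Pi.smul_apply, Pi.zero_apply, smul_eq_mul]
  have hT : (2 * sqSumLT k y) * (1 + m) = 0 := by
    have := congrArg (fun L : 𝔼 n →L[ℝ] ℝ => L yT) hD
    simp only [heval, h1, h2, FunLike.coe_zero, Pi.zero_apply] at this
    linarith
  -- evaluate on the normal part: `2η(1 - K μ') = 0`
  have hN : (2 * sqSumGE k y) * (1 - K * m) = 0 := by
    have := congrArg (fun L : 𝔼 n →L[ℝ] ℝ => L yN) hD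
    simp only [heval, h3, h4, FunLike.coe_zero, Pi.zero_apply] at this
    linarith
  have hξ0 : sqSumLT k y = 0 := by
    have h1m : 0 < 1 + m := by linarith [hmI.1]
    have := mul_eq_zero.1 hT
    rcases this with h | h
    · linarith
    · linarith
  have hη0 : sqSumGE k y = 0 := by
    have h1m : 0 < 1 - K * m := by nlinarith [hmI.2, hK]
    rcases mul_eq_zero.1 hN with h | h
    · linarith
    · linarith
  have hnorm : ‖y‖ ^ 2 = 0 := by rw [← sqSumLT_add_sqSumGE k y, hξ0, hη0, add_zero]
  exact norm_eq_zero.1 (pow_eq_zero_iff two_ne_zero |>.1 hnorm)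

/-- The tangential projection `yᵀ` (normal coordinates set to `0`): it lies in the plane
`{η = 0}`, has the same `ξ`, and `‖y - yᵀ‖² = η(y)`, `‖yᵀ‖² = ξ(y) ≤ ‖y‖²`. [folklore] -/
theorem exists_planeProj (k : ℕ) (y : 𝔼 n) :
    ∃ yT : 𝔼 n, (∀ i : Fin n, k ≤ i.val → yT i = 0) ∧ sqSumLT k yT = sqSumLT k y ∧
      sqSumGE k yT = 0 ∧ ‖y - yT‖ ^ 2 = sqSumGE k y ∧ ‖yT‖ ≤ ‖y‖ := by
  classical
  set yT : 𝔼 n := WithLp.toLp 2 (fun i => if (i : ℕ) < k then y i else 0) with hyT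
  have hyTi : ∀ i : Fin n, yT i = if (i : ℕ) < k then y i else 0 := fun i => rfl
  have hξ : sqSumLT k yT = sqSumLT k y := by
    refine Finset.sum_congr rfl fun i hi => ?_
    obtain ⟨-, hi⟩ := Finset.mem_filter.1 hi
    rw [hyTi, if_pos hi]
  have hη : sqSumGE k yT = 0 := by
    refine Finset.sum_eq_zero fun i hi => ?_
    obtain ⟨-, hi⟩ := Finset.mem_filter.1 hi
    rw [hyTi, if_neg (not_lt.2 hi)]; ring
  have hdiff : ‖y - yT‖ ^ 2 = sqSumGE k y := by
    rw [← sqSumLT_add_sqSumGE k (y - yT)]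
    have h1 : sqSumLT k (y - yT) = 0 := by
      refine Finset.sum_eq_zero fun i hi => ?_
      obtain ⟨-, hi⟩ := Finset.mem_filter.1 hi
      rw [PiLp.sub_apply, hyTi, if_pos hi]; ring
    have h2 : sqSumGE k (y - yT) = sqSumGE k y := by
      refine Finset.sum_congr rfl fun i hi => ?_
      obtain ⟨-, hi⟩ := Finset.mem_filter.1 hi
      rw [PiLp.sub_apply, hyTi, if_neg (not_lt.2 hi)]; ring
    rw [h1, h2, zero_add]
  refine ⟨yT, fun i hi => by rw [hyTi, if_neg (not_lt.2 hi)], hξ, hη, hdiff, ?_⟩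
  have h1 : ‖yT‖ ^ 2 ≤ ‖y‖ ^ 2 := by
    rw [← sqSumLT_add_sqSumGE k yT, ← sqSumLT_add_sqSumGE k y, hξ, hη, add_zero]
    exact le_add_of_nonneg_right (sqSumGE_nonneg k y)
  exact (pow_le_pow_iff_left₀ (norm_nonneg _) (norm_nonneg _) two_ne_zero).1 h1

/-- From `‖y‖² < R²` (`R > 0`) to `‖y‖ < R`. [folklore] -/
theorem norm_lt_of_sq_lt {y : 𝔼 n} {R : ℝ} (hR : 0 < R) (h : ‖y‖ ^ 2 < R ^ 2) : ‖y‖ < R :=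
  lt_of_pow_lt_pow_left₀ 2 hR.le h

end Model

/-! ### The thin-handle function on the manifold -/

section Manifold

variable {n : ℕ} {M : Type*} [TopologicalSpace M] [ChartedSpace (EuclideanSpace ℝ (Fin n)) M]
  [IsManifold (𝓡 n) ∞ M] [T2Space M]

/-- Local notation: `𝔼 n` is the model Euclidean space `EuclideanSpace ℝ (Fin n)`. -/
local notation "𝔼 " n:arg => EuclideanSpace ℝ (Fin n)

open Classical in
/-- The profile term of one Morse chart `e` (index `k`, parameters `ε`, `K`), extended by `0`
off the chart: `x ↦ μ(ξ(e x) + K η(e x))`. [cite: Milnor1963, Thm. 3.2 (proof)] -/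
def handleTerm (e : OpenPartialHomeomorph M (𝔼 n)) (k : ℕ) (ε K : ℝ) (x : M) : ℝ :=
  if x ∈ e.source then handleProfile ε (sqSumLT k (e x) + K * sqSumGE k (e x)) else 0

section Term

variable {e : OpenPartialHomeomorph M (𝔼 n)} {k : ℕ} {ε K R : ℝ} {x : M}

omit [ChartedSpace (EuclideanSpace ℝ (Fin n)) M] [IsManifold (𝓡 n) ∞ M] [T2Space M] in
/-- Unfolding on the chart domain. [folklore] -/
theorem handleTerm_of_mem (hx : x ∈ e.source) :
    handleTerm e k ε K x = handleProfile ε (sqSumLT k (e x) + K * sqSumGE k (e x)) := by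
  simp [handleTerm, hx]

omit [ChartedSpace (EuclideanSpace ℝ (Fin n)) M] [IsManifold (𝓡 n) ∞ M] [T2Space M] in
/-- Unfolding off the chart domain. [folklore] -/
theorem handleTerm_of_not_mem (hx : x ∉ e.source) : handleTerm e k ε K x = 0 := by
  simp [handleTerm, hx]

omit [ChartedSpace (EuclideanSpace ℝ (Fin n)) M] [IsManifold (𝓡 n) ∞ M] [T2Space M] in
/-- `0 ≤` the profile term. [folklore] -/
theorem handleTerm_nonneg (hε : 0 < ε) (x : M) : 0 ≤ handleTerm e k ε K x := by
  by_cases hx : x ∈ e.source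
  · rw [handleTerm_of_mem hx]; exact handleProfile_nonneg hε _
  · rw [handleTerm_of_not_mem hx]

omit [ChartedSpace (EuclideanSpace ℝ (Fin n)) M] [IsManifold (𝓡 n) ∞ M] [T2Space M] in
/-- The profile term is `≤ 9ε/5` (for `K ≥ 0`). [folklore] -/
theorem handleTerm_le (hε : 0 < ε) (hK : 0 ≤ K) (x : M) : handleTerm e k ε K x ≤ 9 / 5 * ε := by
  by_cases hx : x ∈ e.source
  · rw [handleTerm_of_mem hx]
    exact handleProfile_le hε (add_nonneg (sqSumLT_nonneg _ _) (mul_nonneg hK (sqSumGE_nonneg _ _)))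
  · rw [handleTerm_of_not_mem hx]; linarith

omit [ChartedSpace (EuclideanSpace ℝ (Fin n)) M] [IsManifold (𝓡 n) ∞ M] [T2Space M] in
/-- **Where the profile term is nonzero**: inside the chart, with `ξ + K η < 15ε/8` (so
`η < 2ε/K` and `‖e x‖² < 2ε ≤ R²`), hence in the image of the open chart ball of radius `R`.
[cite: Milnor1963, Thm. 3.2 (proof)] -/
theorem mem_of_handleTerm_ne_zero (hε : 0 < ε) (hK : 1 ≤ K) (hR : 0 < R) (hRε : 2 * ε ≤ R ^ 2)
    (hx : handleTerm e k ε K x ≠ 0) :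
    x ∈ e.source ∧ sqSumLT k (e x) + K * sqSumGE k (e x) < 15 * ε / 8 ∧ ‖e x‖ < R ∧
      x ∈ e.symm '' ball (0 : 𝔼 n) R := by
  by_cases hxs : x ∈ e.source
  · rw [handleTerm_of_mem hxs] at hx
    have hq := lt_of_handleProfile_ne_zero hε hx
    have hnorm : ‖e x‖ < R := by
      refine norm_lt_of_sq_lt hR ?_
      have := norm_sq_le_qK (k := k) hK (e x)
      linarith
    exact ⟨hxs, hq, hnorm, ⟨e x, by simpa using hnorm, e.left_inv hxs⟩⟩
  · exact absurd (handleTerm_of_not_mem hxs) hx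

omit [ChartedSpace (EuclideanSpace ℝ (Fin n)) M] [IsManifold (𝓡 n) ∞ M] in
/-- The closed chart ball `e⁻¹(B̄(0, R))` is compact, closed, and contained in the chart domain.
[folklore] -/
theorem isCompact_symm_image_closedBall (hball : closedBall (0 : 𝔼 n) R ⊆ e.target) :
    IsCompact (e.symm '' closedBall (0 : 𝔼 n) R) ∧ IsClosed (e.symm '' closedBall (0 : 𝔼 n) R) ∧
      e.symm '' closedBall (0 : 𝔼 n) R ⊆ e.source := by
  have hc : IsCompact (e.symm '' closedBall (0 : 𝔼 n) R) :=
    (isCompact_closedBall _ _).image_of_continuousOn (e.continuousOn_symm.mono hball)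
  exact ⟨hc, hc.isClosed, fun x ⟨y, hy, hyx⟩ => hyx ▸ e.map_target (hball hy)⟩

omit [ChartedSpace (EuclideanSpace ℝ (Fin n)) M] [IsManifold (𝓡 n) ∞ M] [T2Space M] in
/-- Off the closed chart ball the profile term vanishes (`K ≥ 1`, `2ε ≤ R²`). [folklore] -/
theorem handleTerm_eq_zero_of_not_mem (hε : 0 < ε) (hK : 1 ≤ K) (hR : 0 < R) (hRε : 2 * ε ≤ R ^ 2)
    (hx : x ∉ e.symm '' closedBall (0 : 𝔼 n) R) : handleTerm e k ε K x = 0 := by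
  by_contra hne
  obtain ⟨-, -, -, y, hy, rfl⟩ := mem_of_handleTerm_ne_zero hε hK hR hRε hne
  exact hx ⟨y, ball_subset_closedBall hy, rfl⟩

omit [IsManifold (𝓡 n) ∞ M] in
/-- **The profile term is smooth** on `M`: it is `μ ∘ (ξ + K η) ∘ e` on the chart domain
(`e` in the `C^∞` maximal atlas) and vanishes on the open complement of the closed chart ball.
[folklore] -/
theorem contMDiff_handleTerm (he : e ∈ IsManifold.maximalAtlas (𝓡 n) ∞ M) (hε : 0 < ε)
    (hK : 1 ≤ K) (hR : 0 < R) (hRε : 2 * ε ≤ R ^ 2) (hball : closedBall (0 : 𝔼 n) R ⊆ e.target) :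
    ContMDiff (𝓡 n) 𝓘(ℝ, ℝ) ∞ (handleTerm e k ε K) := by
  have hq : ContDiff ℝ ∞ fun y : 𝔼 n => handleProfile ε (sqSumLT k y + K * sqSumGE k y) :=
    (contDiff_handleProfile ε).comp ((contDiff_sqSumLT k).add (contDiff_const.mul (contDiff_sqSumGE k)))
  have hon : ContMDiffOn (𝓡 n) 𝓘(ℝ, ℝ) ∞ (handleTerm e k ε K) e.source := by
    have h1 : ContMDiffOn (𝓡 n) 𝓘(ℝ, ℝ) ∞
        (fun x => handleProfile ε (sqSumLT k (e x) + K * sqSumGE k (e x))) e.source :=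
      hq.contMDiff.comp_contMDiffOn (contMDiffOn_of_mem_maximalAtlas he)
    exact h1.congr fun x hx => handleTerm_of_mem hx
  obtain ⟨-, hBclosed, hBsub⟩ := isCompact_symm_image_closedBall (e := e) hball
  intro x
  by_cases hx : x ∈ e.source
  · exact hon.contMDiffAt (e.open_source.mem_nhds hx)
  · have hxB : x ∉ e.symm '' closedBall (0 : 𝔼 n) R := fun h => hx (hBsub h)
    have hev : handleTerm e k ε K =ᶠ[𝓝 x] fun _ => 0 := by
      filter_upwards [hBclosed.isOpen_compl.mem_nhds hxB] with z hz
      exact handleTerm_eq_zero_of_not_mem hε hK hR hRε hz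
    exact contMDiffAt_const.congr_of_eventuallyEq hev

omit [T2Space M] in
/-- **Critical points in a chart**: if near `x ∈ e.source` the smooth function `F` is a smooth
model `Φ` read in the chart `e` of the maximal atlas, `F = Φ ∘ e`, and `x` is a critical point
of `F`, then `D Φ (e x) = 0` (`isMCriticalPt_iff_fderiv_comp_extend_symm_eq_zero`, the chart
being boundaryless Euclidean). [folklore] -/
theorem fderiv_eq_zero_of_isMCriticalPt_of_eventuallyEq (he : e ∈ IsManifold.maximalAtlas (𝓡 n) ∞ M)
    (hx : x ∈ e.source) {F : M → ℝ} (hF : ContMDiff (𝓡 n) 𝓘(ℝ, ℝ) ∞ F) {Φ : 𝔼 n → ℝ}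
    (hev : F =ᶠ[𝓝 x] fun z => Φ (e z)) (hcrit : IsMCriticalPt (𝓡 n) F x) :
    fderiv ℝ Φ (e x) = 0 := by
  have he2 : e ∈ IsManifold.maximalAtlas (𝓡 n) 2 M :=
    IsManifold.maximalAtlas_subset_of_le (by norm_cast) he
  have hF2 : ContMDiffAt (𝓡 n) 𝓘(ℝ, ℝ) 2 F x := (hF x).of_le (by norm_cast)
  have h := (isMCriticalPt_iff_fderiv_comp_extend_symm_eq_zero hF2 he2 hx).1 hcrit
  have hcoe : (e.extend (𝓡 n)) x = e x := by simp
  have hsymm : ∀ y, (e.extend (𝓡 n)).symm y = e.symm y := fun y => by simp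
  rw [hcoe] at h
  -- near `e x`, `F ∘ e.extend⁻¹ = Φ`
  have hev' : (F ∘ (e.extend (𝓡 n)).symm) =ᶠ[𝓝 (e x)] Φ := by
    have hpre : ∀ᶠ y in 𝓝 (e x), e.symm y ∈ {z | F z = Φ (e z)} ∧ y ∈ e.target := by
      refine Filter.Eventually.and ?_ (e.open_target.mem_nhds (e.map_source hx))
      have hc : ContinuousAt e.symm (e x) := e.continuousAt_symm (e.map_source hx)
      have hmem : {z | F z = Φ (e z)} ∈ 𝓝 (e.symm (e x)) := by
        rw [e.left_inv hx]; exact hev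
      exact hc.preimage_mem_nhds hmem
    filter_upwards [hpre] with y hy
    simp only [Function.comp_apply, hsymm]
    rw [hy.1, e.right_inv hy.2]
  rwa [hev'.fderiv_eq] at h

end Term

/-- **The thin-handle function** (Milnor 1963, proof of Thm. 3.2, Assertions 1–3, with the
handle made thin). Let `f` be smooth on the `C^∞` manifold `M` (Hausdorff), `c` a level,
`0 < ε`, `0 < R` with `2ε ≤ R²`, and `P` a finite set of points with pairwise disjoint Morse
charts `e_p` of the maximal atlas (`e_p p = 0`, closed ball `B̄(0, R) ⊆ e_p.target`,
`f ∘ e_p⁻¹ = c - ξ + η` on the target, index `λ_p`). Let `N` be an open set containing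
`M^{c-ε}` and the descending discs `e_p⁻¹{η = 0, ξ ≤ ε}`. Then there is a `C^∞` function `F`
— `F = f - Σ_p μ(ξ + K η)` read in the charts, `K` large — with: `F ≤ f ≤ F + 2ε`;
`F ≤ c + ε ⟹ f ≤ c + ε` (so `{F ≤ c + ε} = M^{c+ε}`, Assertion 1); `{F ≤ c - ε} ⊆ N`
(Assertion 3, thin form: a point of `{F ≤ c - ε}` not in `M^{c-ε}` has `η < 2ε/K` and lies
within `√(2ε/K)` of the disc or of `M^{c-ε}` in its chart); `F = f` off the chart balls;
`F(p) ≤ c - 5ε/4` for `p ∈ P`; and every critical point of `F` outside `P` is a critical point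
of `f` at which `F = f` (Assertion 2: in a chart ball `F` is the model `thinHandleModel`, whose
only critical point is the centre). [cite: Milnor1963, Thm. 3.2 (proof)] -/
theorem exists_thinHandleFunction {f : M → ℝ} (hf : ContMDiff (𝓡 n) 𝓘(ℝ, ℝ) ∞ f) {c ε R : ℝ}
    (hε : 0 < ε) (hR : 0 < R) (hRε : 2 * ε ≤ R ^ 2) (P : Finset M) (lam : M → ℕ)
    (e : M → OpenPartialHomeomorph M (𝔼 n))
    (he : ∀ p ∈ P, e p ∈ IsManifold.maximalAtlas (𝓡 n) ∞ M)
    (hpe : ∀ p ∈ P, p ∈ (e p).source ∧ e p p = 0)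
    (hball : ∀ p ∈ P, closedBall (0 : 𝔼 n) R ⊆ (e p).target)
    (hquad : ∀ p ∈ P, ∀ y ∈ (e p).target,
      f ((e p).symm y) = c - sqSumLT (lam p) y + sqSumGE (lam p) y)
    (hdisj : ∀ p ∈ P, ∀ p' ∈ P, p ≠ p' →
      Disjoint ((e p).symm '' closedBall (0 : 𝔼 n) R) ((e p').symm '' closedBall (0 : 𝔼 n) R))
    {N : Set M} (hN : IsOpen N) (hNf : f ⁻¹' Iic (c - ε) ⊆ N)
    (hND : ∀ p ∈ P, ∀ y : 𝔼 n, (∀ i : Fin n, lam p ≤ i.val → y i = 0) →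
      sqSumLT (lam p) y ≤ ε → (e p).symm y ∈ N) :
    ∃ F : M → ℝ, ContMDiff (𝓡 n) 𝓘(ℝ, ℝ) ∞ F ∧ (∀ x, F x ≤ f x) ∧ (∀ x, f x ≤ F x + 2 * ε) ∧
      (∀ x, F x ≤ c + ε → f x ≤ c + ε) ∧ F ⁻¹' Iic (c - ε) ⊆ N ∧
      (∀ x, (∀ p ∈ P, x ∉ (e p).symm '' closedBall (0 : 𝔼 n) R) → F x = f x) ∧
      (∀ p ∈ P, F p ≤ c - 5 / 4 * ε) ∧
      (∀ x, IsMCriticalPt (𝓡 n) F x → x ∉ P → IsMCriticalPt (𝓡 n) f x ∧ F x = f x) := by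
  classical
  -- Step 0: the compact sets `Q_p` (disc ∪ sublevel part of the closed chart ball), margins `θ_p`
  have hθ : ∀ p ∈ P, ∃ θ : ℝ, 0 < θ ∧ ∀ y : 𝔼 n, ‖y‖ < R →
      (∃ y' : 𝔼 n, ‖y'‖ ≤ R ∧ dist y y' < θ ∧
        (((∀ i : Fin n, lam p ≤ i.val → y' i = 0) ∧ sqSumLT (lam p) y' ≤ ε) ∨
          f ((e p).symm y') ≤ c - ε)) → (e p).symm y ∈ N := by
    intro p hp
    set Q : Set (𝔼 n) := (closedBall 0 R ∩ {y | (∀ i : Fin n, lam p ≤ i.val → y i = 0) ∧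
        sqSumLT (lam p) y ≤ ε}) ∪ (closedBall 0 R ∩ (fun y => f ((e p).symm y)) ⁻¹' Iic (c - ε))
      with hQ
    set V : Set (𝔼 n) := (e p).target ∩ (e p).symm ⁻¹' N with hV
    have hVo : IsOpen V := (e p).continuousOn_symm.isOpen_inter_preimage (e p).open_target hN
    have hQc : IsCompact Q := by
      refine ((isCompact_closedBall _ _).inter_right ?_).union
        ((isCompact_closedBall (0 : 𝔼 n) R).of_isClosed_subset ?_ inter_subset_left)
      · have h1 : IsClosed {y : 𝔼 n | ∀ i : Fin n, lam p ≤ i.val → y i = 0} := by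
          have : {y : 𝔼 n | ∀ i : Fin n, lam p ≤ i.val → y i = 0} =
              ⋂ i ∈ (Finset.univ.filter fun i : Fin n => lam p ≤ i.val), {y : 𝔼 n | y i = 0} := by
            ext y; simp
          rw [this]
          exact isClosed_biInter fun i _ =>
            isClosed_eq (EuclideanSpace.proj (𝕜 := ℝ) i).continuous continuous_const
        exact h1.inter (isClosed_le (continuous_sqSumLT _) continuous_const)
      · exact (hf.continuous.comp_continuousOn ((e p).continuousOn_symm.mono (hball p hp)))
          |>.preimage_isClosed_of_isClosed isClosed_closedBall isClosed_Iic
    have hQV : Q ⊆ V := by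
      rintro y (⟨hyR, hpl, hξ⟩ | ⟨hyR, hyf⟩)
      · exact ⟨hball p hp hyR, hND p hp y hpl hξ⟩
      · exact ⟨hball p hp hyR, hNf hyf⟩
    obtain ⟨θ, hθpos, hθsub⟩ := hQc.exists_cthickening_subset_open hVo hQV
    refine ⟨θ, hθpos, fun y hyR ⟨y', hy'R, hdist, hy'⟩ => ?_⟩
    have hy'Q : y' ∈ Q := by
      rcases hy' with h | h
      · exact Or.inl ⟨mem_closedBall_zero_iff.2 hy'R, h⟩
      · exact Or.inr ⟨mem_closedBall_zero_iff.2 hy'R, h⟩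
    have hyV : y ∈ V :=
      hθsub (thickening_subset_cthickening θ Q (mem_thickening_iff.2 ⟨y', hy'Q, hdist⟩))
    exact hyV.2
  choose! θ hθpos hθN using hθ
  -- Step 1: the constant `K` and the function `F`
  set K : ℝ := 2 + ∑ p ∈ P, 2 * ε / θ p ^ 2 with hK
  have hK2 : 2 ≤ K := by
    rw [hK]
    have : 0 ≤ ∑ p ∈ P, 2 * ε / θ p ^ 2 :=
      Finset.sum_nonneg fun p hp => div_nonneg (by linarith) (sq_nonneg _)
    linarith
  have hK1 : 1 ≤ K := by linarith
  have hK0 : 0 ≤ K := by linarith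
  have hKθ : ∀ p ∈ P, 2 * ε / K ≤ θ p ^ 2 := by
    intro p hp
    have hθ2 : 0 < θ p ^ 2 := pow_pos (hθpos p hp) 2
    have hle : 2 * ε / θ p ^ 2 ≤ K := by
      rw [hK]
      have := Finset.single_le_sum (f := fun p => 2 * ε / θ p ^ 2)
        (fun p _ => div_nonneg (by linarith) (sq_nonneg _)) hp
      linarith
    rw [div_le_iff₀ (by linarith : (0 : ℝ) < K)]
    rw [div_le_iff₀ hθ2] at hle
    linarith
  set T : M → M → ℝ := fun p x => handleTerm (e p) (lam p) ε K x with hT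
  set F : M → ℝ := fun x => f x - ∑ p ∈ P, T p x with hF
  -- the closed chart balls
  set B : M → Set M := fun p => (e p).symm '' closedBall (0 : 𝔼 n) R with hB
  have hBc : ∀ p ∈ P, IsClosed (B p) ∧ B p ⊆ (e p).source := fun p hp =>
    ⟨(isCompact_symm_image_closedBall (hball p hp)).2.1,
      (isCompact_symm_image_closedBall (hball p hp)).2.2⟩
  -- Step 2: at most one term is nonzero at each point
  have hT0 : ∀ p ∈ P, ∀ x, x ∉ B p → T p x = 0 := fun p hp x hx =>
    handleTerm_eq_zero_of_not_mem hε hK1 hR hRε hx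
  have hTmem : ∀ p ∈ P, ∀ x, T p x ≠ 0 → x ∈ B p := fun p hp x hx => by
    by_contra h; exact hx (hT0 p hp x h)
  have hsum : ∀ x, (∑ p ∈ P, T p x = 0) ∨ ∃ p ∈ P, ∑ p' ∈ P, T p' x = T p x ∧ T p x ≠ 0 := by
    intro x
    by_cases h : ∃ p ∈ P, T p x ≠ 0
    · obtain ⟨p, hp, hpx⟩ := h
      refine Or.inr ⟨p, hp, Finset.sum_eq_single p (fun p' hp' hne => ?_) (fun h => absurd hp h), hpx⟩
      by_contra hne'
      have h1 := hTmem p hp x hpx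
      have h2 := hTmem p' hp' x hne'
      exact Set.disjoint_left.1 (hdisj p hp p' hp' (Ne.symm hne)) h1 h2
    · push Not at h
      exact Or.inl (Finset.sum_eq_zero h)
  have hsum_nonneg : ∀ x, 0 ≤ ∑ p ∈ P, T p x := fun x =>
    Finset.sum_nonneg fun p _ => handleTerm_nonneg hε x
  have hsum_le : ∀ x, ∑ p ∈ P, T p x ≤ 2 * ε := fun x => by
    rcases hsum x with h | ⟨p, hp, h, -⟩
    · rw [h]; linarith
    · rw [h]; linarith [handleTerm_le (e := e p) (k := lam p) (K := K) hε hK0 x]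
  -- in a chart: the values of `f`
  have hfval : ∀ p ∈ P, ∀ x ∈ (e p).source,
      f x = c - sqSumLT (lam p) (e p x) + sqSumGE (lam p) (e p x) := fun p hp x hx => by
    conv_lhs => rw [← (e p).left_inv hx]
    exact hquad p hp _ ((e p).map_source hx)
  -- smoothness of `F`
  have hTsm : ∀ p ∈ P, ContMDiff (𝓡 n) 𝓘(ℝ, ℝ) ∞ (T p) := fun p hp =>
    contMDiff_handleTerm (he p hp) hε hK1 hR hRε (hball p hp)
  have hsumsm : ∀ S : Finset M, S ⊆ P → ContMDiff (𝓡 n) 𝓘(ℝ, ℝ) ∞ fun x => ∑ p ∈ S, T p x := by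
    intro S hS
    induction S using Finset.induction_on with
    | empty => simpa using contMDiff_const
    | insert a S ha ih =>
      have h1 := hTsm a (hS (Finset.mem_insert_self a S))
      have h2 := ih (fun p hp => hS (Finset.mem_insert_of_mem hp))
      have h3 : (fun x => ∑ p ∈ insert a S, T p x) = fun x => T a x + ∑ p ∈ S, T p x :=
        funext fun x => Finset.sum_insert ha
      rw [h3]
      exact h1.add h2
  have hFsm : ContMDiff (𝓡 n) 𝓘(ℝ, ℝ) ∞ F := hf.sub (hsumsm P subset_rfl)
  refine ⟨F, hFsm, fun x => ?_, fun x => ?_, fun x hx => ?_, fun x hx => ?_, fun x hx => ?_,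
    fun p hp => ?_, fun x hxc hxP => ?_⟩
  · -- `F ≤ f`
    show f x - ∑ p ∈ P, T p x ≤ f x
    linarith [hsum_nonneg x]
  · -- `f ≤ F + 2ε`
    show f x ≤ f x - ∑ p ∈ P, T p x + 2 * ε
    linarith [hsum_le x]
  · -- `{F ≤ c + ε} ⊆ {f ≤ c + ε}`
    change f x - ∑ p ∈ P, T p x ≤ c + ε at hx
    rcases hsum x with h | ⟨p, hp, h, hne⟩
    · rw [h] at hx; linarith
    · obtain ⟨hxs, hq, -, -⟩ := mem_of_handleTerm_ne_zero hε hK1 hR hRε hne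
      have hξ := sqSumLT_nonneg (lam p) (e p x)
      have hη := sqSumGE_nonneg (lam p) (e p x)
      have hη1 : sqSumGE (lam p) (e p x) ≤ ε := by
        by_contra hlt
        rw [not_le] at hlt
        nlinarith
      rw [hfval p hp x hxs]
      linarith
  · -- `{F ≤ c - ε} ⊆ N`
    change f x - ∑ p ∈ P, T p x ≤ c - ε at hx
    rcases hsum x with h | ⟨p, hp, h, hne⟩
    · rw [h, sub_zero] at hx
      exact hNf hx
    · obtain ⟨hxs, hq, hnormR, -⟩ := mem_of_handleTerm_ne_zero hε hK1 hR hRε hne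
      set y := e p x with hy
      have hξ := sqSumLT_nonneg (lam p) y
      have hη := sqSumGE_nonneg (lam p) y
      have hηK : sqSumGE (lam p) y < θ p ^ 2 := by
        have h1 : K * sqSumGE (lam p) y < 2 * ε := by linarith
        have h2 := hKθ p hp
        have hKpos : (0 : ℝ) < K := by linarith
        rw [div_le_iff₀ hKpos] at h2
        nlinarith
      obtain ⟨yT, hplane, hξT, hηT, hdist, hnormT⟩ := exists_planeProj (lam p) y
      have hmem : (e p).symm y ∈ N := by
        refine hθN p hp y hnormR ⟨yT, by linarith, ?_, ?_⟩
        · rw [dist_eq_norm]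
          exact lt_of_pow_lt_pow_left₀ 2 (hθpos p hp).le (by rw [hdist]; exact hηK)
        · by_cases hξε : sqSumLT (lam p) y ≤ ε
          · exact Or.inl ⟨hplane, by rw [hξT]; exact hξε⟩
          · right
            have hyT : yT ∈ (e p).target := hball p hp (mem_closedBall_zero_iff.2 (by linarith))
            rw [hquad p hp yT hyT, hξT, hηT]
            push Not at hξε
            linarith
      rwa [hy, (e p).left_inv hxs] at hmem
  · -- `F = f` off the chart balls
    show f x - ∑ p ∈ P, T p x = f x
    rw [Finset.sum_eq_zero fun p hp => hT0 p hp x (hx p hp), sub_zero]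
  · -- `F p ≤ c - 5ε/4`
    obtain ⟨hps, hp0⟩ := hpe p hp
    show f p - ∑ p' ∈ P, T p' p ≤ c - 5 / 4 * ε
    have hfp : f p = c := by
      rw [hfval p hp p hps, hp0]
      simp [sqSumLT, sqSumGE]
    have hTp : T p p = handleProfile ε 0 := by
      show handleTerm (e p) (lam p) ε K p = _
      rw [handleTerm_of_mem hps, hp0]
      simp [sqSumLT, sqSumGE]
    have hge : T p p ≤ ∑ p' ∈ P, T p' p :=
      Finset.single_le_sum (f := fun p' => T p' p) (fun p' _ => handleTerm_nonneg hε p) hp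
    have := le_handleProfile_zero hε
    linarith
  · -- critical points of `F` outside `P`
    by_cases hxB : ∃ p ∈ P, x ∈ B p
    · -- inside a chart ball: `F` is the model, whose only critical point is the centre
      exfalso
      obtain ⟨p, hp, hxBp⟩ := hxB
      have hxs : x ∈ (e p).source := (hBc p hp).2 hxBp
      -- the open set `O = source ∖ ⋃_{p' ≠ p} B_{p'}` around `x`, on which `F = model ∘ e_p`
      set O : Set M := (e p).source ∩ (⋃ p' ∈ P.erase p, B p')ᶜ with hO
      have hOo : IsOpen O :=
        (e p).open_source.inter
          (isClosed_biUnion_finset fun p' hp' => (hBc p' (Finset.mem_of_mem_erase hp')).1).isOpen_compl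
      have hxO : x ∈ O := by
        refine ⟨hxs, fun hx' => ?_⟩
        obtain ⟨p', hp', hxp'⟩ := mem_iUnion₂.1 hx'
        have hne : p' ≠ p := Finset.ne_of_mem_erase hp'
        exact Set.disjoint_left.1 (hdisj p hp p' (Finset.mem_of_mem_erase hp') hne.symm) hxBp hxp'
      have hFO : ∀ z ∈ O, F z = thinHandleModel (lam p) c ε K (e p z) := by
        intro z hz
        have hsum' : ∑ p' ∈ P, T p' z = T p z := by
          refine Finset.sum_eq_single p (fun p' hp' hne => hT0 p' hp' z fun h => hz.2 ?_)
            (fun h => absurd hp h)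
          exact mem_iUnion₂.2 ⟨p', Finset.mem_erase.2 ⟨hne, hp'⟩, h⟩
        show f z - ∑ p' ∈ P, T p' z = _
        rw [hsum', hfval p hp z hz.1]
        show _ - handleTerm (e p) (lam p) ε K z = _
        rw [handleTerm_of_mem hz.1, thinHandleModel]
      have hev : F =ᶠ[𝓝 x] fun z => thinHandleModel (lam p) c ε K (e p z) := by
        filter_upwards [hOo.mem_nhds hxO] with z hz
        exact hFO z hz
      have hD := fderiv_eq_zero_of_isMCriticalPt_of_eventuallyEq (he p hp) hxs hFsm hev hxc
      have hex : e p x = 0 := eq_zero_of_fderiv_thinHandleModel_eq_zero hK0 hD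
      have hxp : x = p := by
        obtain ⟨hps, hp0⟩ := hpe p hp
        rw [← (e p).left_inv hxs, hex, ← hp0, (e p).left_inv hps]
      exact hxP (hxp ▸ hp)
    · -- outside all chart balls: `F = f` near `x`
      push Not at hxB
      have hev : F =ᶠ[𝓝 x] f := by
        have hopen : IsOpen (⋃ p ∈ P, B p)ᶜ :=
          (isClosed_biUnion_finset fun p hp => (hBc p hp).1).isOpen_compl
        have hxU : x ∈ (⋃ p ∈ P, B p)ᶜ := fun h => by
          obtain ⟨p, hp, hxp⟩ := mem_iUnion₂.1 h
          exact hxB p hp hxp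
        filter_upwards [hopen.mem_nhds hxU] with z hz
        show f z - ∑ p ∈ P, T p z = f z
        rw [Finset.sum_eq_zero fun p hp => hT0 p hp z fun h => hz (mem_iUnion₂.2 ⟨p, hp, h⟩),
          sub_zero]
      refine ⟨?_, hev.self_of_nhds⟩
      unfold IsMCriticalPt at hxc ⊢
      rwa [hev.mfderiv_eq] at hxc

end Manifold

end Literature.Topology.FourManifolds
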